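import Mathlib
import HarnessLib
import Summits.QuantumAdvantage.QuantumAdvantage.Theses.NeedleThreshold

/-!
# Line `birth` — BC3 skeleton for the crux `NeedleBPP` (stmt-QuantumAdvantage-9896)

Route `NeedleThreshold` (route-QuantumAdvantage-NeedleThreshold; REFUTATION side, the deciding theorem is
`closes (h₁ : NeedleDetector) (h₂ : NeedleBPP) (h₃ : GuidedHardness) : ¬ QuantumAdvantage`), crux (rank 3)

  `NeedleBPP := ⟨NeedleDetector, inlined⟩ → ∀ K (χ₀ > 0), GLH(K, χ₀) ∈ PromiseBPP'`,

where GLH(K, χ₀) is the guided Pauli-Hamiltonian decision problem of the route file: instance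
`I = ⟨n, (terms, (guide, (α, (β, D))))⟩`, `H = Σ_t (p_t + q_t √2) · P_t` (Pauli strings), `Λ = Σ_t |p_t + q_t √2|`,
signed subset-state guide `u = Σ ±e_x`, thresholds `α/(D+1) < β/(D+1)` (relative to `Λ`) with gap
`≥ 1/(K (log₂ n)² + 1)`; YES: some eigenvector of `H` with eigenvalue `l ≤ αΛ/(D+1)` has overlap `≥ χ₀` with
`u/‖u‖`; NO: `spec H ≥ βΛ/(D+1)`.

## The line (the route's own two-layer plan, cut along the mathematics / algorithm seam)

Normalise `A := H/(2Λ)` (spectrum in `[-1/2, 1/2]` because every Pauli string is a Hermitian unitary, so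
`‖H‖ ≤ Λ`), `a := α/(2(D+1))`, `b := β/(2(D+1))`, and let `M(p) := Σ_k coeff_k(p) · Re ⟨u, A^k u⟩` be the
MOMENT FUNCTIONAL of a real polynomial `p` — the quantity Le Gall's Pauli-path sampler estimates.  A ONE-SIDED
DETECTOR for the window `(a, b)` at level `δ` is a real polynomial with `p ≥ 1` on `[-1, a]`, `p ≥ 0` on `[a, b]`,
`|p| ≤ δ` on `[b, 1]` (exactly the shape produced by the route's support item `NeedleDetector`).

* `stub_detectorGap` (M, TRUE — finite-dimensional spectral theorem): the GLH promise is contained in the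
  MOMENT promise: a YES instance has `a ≥ -1/2` and either `b > 1/2` or `M(p) ≥ (χ₀² − δ)‖u‖²` for EVERY detector
  `(p, δ)` of its window; a NO instance has `b ≤ 1/2` and either `a < -1/2` or `M(p) ≤ δ‖u‖²` for every detector.
  Proof sketch: `H` is Hermitian (`Pauli.conjTranspose_mat`, real weights), take an orthonormal eigenbasis
  (`Matrix.IsHermitian.eigenvectorBasis`), eigenvalues of `A` lie in `[-1/2, 1/2]` (`‖P_t‖ = 1`), and
  `M(p) = Σ_j p(μ_j) |⟨v_j, u⟩|²`; in the YES case the eigenspace of the witness eigenvalue `μ ≤ a` carries weight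
  `≥ χ₀²‖u‖²` (Cauchy–Schwarz inside the eigenspace), the window `[a, b]` contributes `≥ 0` and `[b, 1]`
  contributes `≥ −δ‖u‖²`; in the NO case every `μ_j ∈ [b, 1/2]`, so `|M(p)| ≤ δ‖u‖²`.  The side conditions
  `a ≥ -1/2` (YES) and `b ≤ 1/2` (NO) are `|μ_j| ≤ 1/2` applied to the witness / to any eigenvector.
* `stub_momentThresholdBPP` (L, LOAD-BEARING — the algorithmic heart, card T3): granted the needle detector
  (the route's `NeedleDetector`, verbatim the antecedent of the crux), the MOMENT promise problem is in
  `PromiseBPP'` for every `K` and `χ₀ > 0`: decode; reject if `Λ = 0`, the gap inequality fails, `u = 0` or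
  `a < -1/2`; accept if `b > 1/2`; otherwise `-1/2 ≤ a < b ≤ 1/2`, `b − a ≥ 1/(2(K log₂² n + 1))`: take a detector
  `p = Σ c_k x^k` for `(a, b, ε = b − a, δ₀ = min(χ₀², 1)/4)` with `W := Σ|c_k| ≤ (2/δ₀)^{C/√ε} = n^{O(√K)}` and
  `deg p = O(log n · √K)`, estimate `M(p)/‖u‖² = Σ_k c_k ⟨û|A^k|û⟩` by `N = O(W²/δ₀²)` Pauli-path samples (path
  `(t₁,…,t_k)` drawn with probability `Π|w_{t_i}|/Λ^k` up to dyadic rounding of the `ℤ[√2]` weights, value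
  `2^{-k} · sgn · ⟨û|P_{t₁}⋯P_{t_k}|û⟩ ∈ [-1, 1]` evaluated exactly on the guide's support), accept iff the
  estimate is `≥ 2δ₀` (moment-YES gives `≥ 3δ₀`, moment-NO gives `≤ δ₀`; Hoeffding).  The detector must be
  COMPUTED by the machine: the explicit even Chebyshev detector `T_d(y(x))/T_d(y(a))` has rational coefficients
  for rational `a, b`; the hypothesis is the existence statement that calibrates `C`.  Why it might fail: as for
  the crux — a hidden `4^deg` in the one-sample range or in the rounding budget would break `n^{O(√K)}`.
* Composition (sorry-free): `PromiseBPP'` is monotone under shrinking the promise (`mem_PromiseBPP'_of_subset`,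
  proved here) and `Encoding.toLanguage` is monotone; so detector gap + moment decision give the crux.
  `NeedleBPP_of : NeedleBPP` is the ONLY theorem whose head is the crux decl; `needleBPP_of_stubs` takes the two
  stub statements as hypotheses and concludes the unfolded crux.

Disproof used: none exists for this crux (`ledger crux ls stmt-QuantumAdvantage-9896`: no workfiles, no
`Disproof.lean`, no Negative lemmas) — nothing to honour or avoid beyond the route's own kill criteria.
`sorry` occurs ONLY in the two `stub_*` theorems.
-/

set_option linter.dupNamespace false
set_option linter.unusedVariables false

noncomputable section

namespace Summit.QuantumAdvantage.QuantumAdvantage.Cruxes.NeedleBPP.Birth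

open Summit.QuantumAdvantage.QuantumAdvantage.Theses.NeedleThreshold
open Literature.Computability.Complexity

/-! ## The objects of the crux, named (verbatim sub-terms of the route decl `NeedleBPP`) -/

/-- Instances of GLH: `⟨n, (terms, (guide, (α, (β, D))))⟩` — `n` qubits, Pauli terms with `ℤ[√2]` weights
(`((p, q), (xmask, zmask))`), a signed subset-state guide, integer thresholds `α, β` over `D + 1`. [folklore] -/
abbrev Inst : Type :=
  Σ n : ℕ, List ((ℤ × ℤ) × ((Fin n → Bool) × (Fin n → Bool))) × (List (Bool × (Fin n → Bool)) × (ℤ × ℤ × ℕ))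

/-- The Boolean encoding of instances (verbatim the one in `NeedleBPP` / `GuidedHardness`). [folklore] -/
def instEncoding : Computability.Encoding Inst Bool :=
  Computability.Encoding.sigmaBool (F := fun n : ℕ => List ((ℤ × ℤ) × ((Fin n → Bool) × (Fin n → Bool))) × (List (Bool × (Fin n → Bool)) × (ℤ × ℤ × ℕ))) (fun n : ℕ => (((Literature.Computability.Complexity.encodingIntBool.pairBool Literature.Computability.Complexity.encodingIntBool).pairBool ((Literature.Computability.Complexity.encodingBitVec n).pairBool (Literature.Computability.Complexity.encodingBitVec n))).listBool).pairBool (((Computability.encodingBoolBool.pairBool (Literature.Computability.Complexity.encodingBitVec n)).listBool).pairBool (Literature.Computability.Complexity.encodingIntBool.pairBool (Literature.Computability.Complexity.encodingIntBool.pairBool Computability.encodingNatBool))))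

/-- YES instances of GLH(K, χ₀) (verbatim the yes-set of `NeedleBPP`). [folklore] -/
def glhYes (K : ℕ) (χ₀ : ℝ) : Set Inst :=
  {I | ∃ (n : ℕ) (terms : List ((ℤ × ℤ) × ((Fin n → Bool) × (Fin n → Bool)))) (guide : List (Bool × (Fin n → Bool))) (α β : ℤ) (D : ℕ), I = ⟨n, (terms, (guide, (α, (β, D))))⟩ ∧ let H : Matrix (Fin n → Bool) (Fin n → Bool) ℂ := (terms.map fun t => ((((t.1.1 : ℝ) + (t.1.2 : ℝ) * Real.sqrt 2 : ℝ) : ℂ) • Literature.Computability.QuantumComplexity.pauliString fun i => if t.2.1 i then (if t.2.2 i then Literature.Computability.QuantumComplexity.Pauli.Y else Literature.Computability.QuantumComplexity.Pauli.X) else (if t.2.2 i then Literature.Computability.QuantumComplexity.Pauli.Z else Literature.Computability.QuantumComplexity.Pauli.I))).sum; let Λ : ℝ := (terms.map fun t => |(t.1.1 : ℝ) + (t.1.2 : ℝ) * Real.sqrt 2|).sum; let u : (Fin n → Bool) → ℂ := fun y => (guide.map fun g => if g.2 = y then (if g.1 then (-1 : ℂ) else 1) else 0).sum; 0 < Λ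 ∧ ((D : ℝ) + 1) ≤ ((β : ℝ) - α) * (((K : ℕ) : ℝ) * (Nat.log 2 n : ℝ) ^ 2 + 1) ∧ 0 < ∑ y, ‖u y‖ ^ 2 ∧ ∃ (l : ℝ) (v : (Fin n → Bool) → ℂ), v ≠ 0 ∧ H.mulVec v = (l : ℂ) • v ∧ l * ((D : ℝ) + 1) ≤ (α : ℝ) * Λ ∧ (χ₀ : ℝ) ^ 2 * (∑ y, ‖u y‖ ^ 2) * (∑ y, ‖v y‖ ^ 2) ≤ ‖∑ y, star (u y) * v y‖ ^ 2}

/-- NO instances of GLH(K) (verbatim the no-set of `NeedleBPP`; it does not depend on `χ₀`). [folklore] -/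
def glhNo (K : ℕ) : Set Inst :=
  {I | ∃ (n : ℕ) (terms : List ((ℤ × ℤ) × ((Fin n → Bool) × (Fin n → Bool)))) (guide : List (Bool × (Fin n → Bool))) (α β : ℤ) (D : ℕ), I = ⟨n, (terms, (guide, (α, (β, D))))⟩ ∧ let H : Matrix (Fin n → Bool) (Fin n → Bool) ℂ := (terms.map fun t => ((((t.1.1 : ℝ) + (t.1.2 : ℝ) * Real.sqrt 2 : ℝ) : ℂ) • Literature.Computability.QuantumComplexity.pauliString fun i => if t.2.1 i then (if t.2.2 i then Literature.Computability.QuantumComplexity.Pauli.Y else Literature.Computability.QuantumComplexity.Pauli.X) else (if t.2.2 i then Literature.Computability.QuantumComplexity.Pauli.Z else Literature.Computability.QuantumComplexity.Pauli.I))).sum; let Λ : ℝ := (terms.map fun t => |(t.1.1 : ℝ) + (t.1.2 : ℝ) * Real.sqrt 2|).sum; 0 < Λ ∧ ((D : ℝ) + 1) ≤ ((β : ℝ) - α) * (((K : ℕ) : ℝ) * (Nat.log 2 n : ℝ) ^ 2 + 1) ∧ ∀ (l : ℝ) (v : (Fin n → Bool) → ℂ), v ≠ 0 → H.mulVec v =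 (l : ℂ) • v → (β : ℝ) * Λ ≤ l * ((D : ℝ) + 1)}

/-- The promise problem GLH(K, χ₀) of the route, named. [folklore] -/
def glhProblem (K : ℕ) (χ₀ : ℝ) : PromiseProblem :=
  PromiseProblem.ofEncoding instEncoding (glhYes K χ₀) (glhNo K)

/-- MOMENT-YES instances: data well formed (`Λ > 0`, gap, `u ≠ 0`), lower threshold `a = α/(2(D+1)) ≥ -1/2`, and
either the upper threshold `b = β/(2(D+1))` exceeds `1/2` (then NO is impossible) or every one-sided detector
`(p, δ)` of the window `(a, b)` has moment functional `M(p) ≥ (χ₀² − δ) · ‖u‖²`, where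
`M(p) = Σ_k coeff_k(p) · Re ⟨u, (H/(2Λ))^k u⟩`. [folklore] -/
def momentYes (K : ℕ) (χ₀ : ℝ) : Set Inst :=
  {I | ∃ (n : ℕ) (terms : List ((ℤ × ℤ) × ((Fin n → Bool) × (Fin n → Bool))))
      (guide : List (Bool × (Fin n → Bool))) (α β : ℤ) (D : ℕ), I = ⟨n, (terms, (guide, (α, (β, D))))⟩ ∧
    let H : Matrix (Fin n → Bool) (Fin n → Bool) ℂ := (terms.map fun t => ((((t.1.1 : ℝ) + (t.1.2 : ℝ) * Real.sqrt 2 : ℝ) : ℂ) • Literature.Computability.QuantumComplexity.pauliString fun i => if t.2.1 i then (if t.2.2 i then Literature.Computability.QuantumComplexity.Pauli.Y else Literature.Computability.QuantumComplexity.Pauli.X) else (if t.2.2 i then Literature.Computability.QuantumComplexity.Pauli.Z else Literature.Computability.QuantumComplexity.Pauli.I))).sum;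
    let Λ : ℝ := (terms.map fun t => |(t.1.1 : ℝ) + (t.1.2 : ℝ) * Real.sqrt 2|).sum;
    let u : (Fin n → Bool) → ℂ := fun y => (guide.map fun g => if g.2 = y then (if g.1 then (-1 : ℂ) else 1) else 0).sum;
    let a : ℝ := (α : ℝ) / (2 * ((D : ℝ) + 1));
    let b : ℝ := (β : ℝ) / (2 * ((D : ℝ) + 1));
    let A : Matrix (Fin n → Bool) (Fin n → Bool) ℂ := (((1 : ℝ) / (2 * Λ) : ℝ) : ℂ) • H;
    let M : Polynomial ℝ → ℝ := fun p =>
      ∑ k ∈ Finset.range (p.natDegree + 1), p.coeff k * (∑ y, star (u y) * (A ^ k).mulVec u y).re;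
    0 < Λ ∧ ((D : ℝ) + 1) ≤ ((β : ℝ) - α) * (((K : ℕ) : ℝ) * (Nat.log 2 n : ℝ) ^ 2 + 1) ∧
      0 < ∑ y, ‖u y‖ ^ 2 ∧ -(1 / 2 : ℝ) ≤ a ∧
      ((1 / 2 : ℝ) < b ∨
        (b ≤ 1 / 2 ∧ ∀ (δ : ℝ) (p : Polynomial ℝ), 0 < δ →
          (∀ x ∈ Set.Icc (-1 : ℝ) a, 1 ≤ p.eval x) → (∀ x ∈ Set.Icc a b, 0 ≤ p.eval x) →
          (∀ x ∈ Set.Icc b 1, |p.eval x| ≤ δ) →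
          (χ₀ ^ 2 - δ) * (∑ y, ‖u y‖ ^ 2) ≤ M p))}

/-- MOMENT-NO instances: data well formed (`Λ > 0`, gap), upper threshold `b ≤ 1/2`, and either `a < -1/2`
(then YES is impossible) or every one-sided detector `(p, δ)` of the window `(a, b)` has `M(p) ≤ δ · ‖u‖²`
(automatic when `u = 0`). [folklore] -/
def momentNo (K : ℕ) : Set Inst :=
  {I | ∃ (n : ℕ) (terms : List ((ℤ × ℤ) × ((Fin n → Bool) × (Fin n → Bool))))
      (guide : List (Bool × (Fin n → Bool))) (α β : ℤ) (D : ℕ), I = ⟨n, (terms, (guide, (α, (β, D))))⟩ ∧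
    let H : Matrix (Fin n → Bool) (Fin n → Bool) ℂ := (terms.map fun t => ((((t.1.1 : ℝ) + (t.1.2 : ℝ) * Real.sqrt 2 : ℝ) : ℂ) • Literature.Computability.QuantumComplexity.pauliString fun i => if t.2.1 i then (if t.2.2 i then Literature.Computability.QuantumComplexity.Pauli.Y else Literature.Computability.QuantumComplexity.Pauli.X) else (if t.2.2 i then Literature.Computability.QuantumComplexity.Pauli.Z else Literature.Computability.QuantumComplexity.Pauli.I))).sum;
    let Λ : ℝ := (terms.map fun t => |(t.1.1 : ℝ) + (t.1.2 : ℝ) * Real.sqrt 2|).sum;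
    let u : (Fin n → Bool) → ℂ := fun y => (guide.map fun g => if g.2 = y then (if g.1 then (-1 : ℂ) else 1) else 0).sum;
    let a : ℝ := (α : ℝ) / (2 * ((D : ℝ) + 1));
    let b : ℝ := (β : ℝ) / (2 * ((D : ℝ) + 1));
    let A : Matrix (Fin n → Bool) (Fin n → Bool) ℂ := (((1 : ℝ) / (2 * Λ) : ℝ) : ℂ) • H;
    let M : Polynomial ℝ → ℝ := fun p =>
      ∑ k ∈ Finset.range (p.natDegree + 1), p.coeff k * (∑ y, star (u y) * (A ^ k).mulVec u y).re;
    0 < Λ ∧ ((D : ℝ) + 1) ≤ ((β : ℝ) - α) * (((K : ℕ) : ℝ) * (Nat.log 2 n : ℝ) ^ 2 + 1) ∧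
      b ≤ 1 / 2 ∧
      (a < -(1 / 2 : ℝ) ∨
        (-(1 / 2 : ℝ) ≤ a ∧ ∀ (δ : ℝ) (p : Polynomial ℝ), 0 < δ →
          (∀ x ∈ Set.Icc (-1 : ℝ) a, 1 ≤ p.eval x) → (∀ x ∈ Set.Icc a b, 0 ≤ p.eval x) →
          (∀ x ∈ Set.Icc b 1, |p.eval x| ≤ δ) →
          M p ≤ δ * (∑ y, ‖u y‖ ^ 2)))}

/-- The MOMENT promise problem (moment-YES, moment-NO) under the same encoding. [folklore] -/
def momentProblem (K : ℕ) (χ₀ : ℝ) : PromiseProblem :=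
  PromiseProblem.ofEncoding instEncoding (momentYes K χ₀) (momentNo K)

/-! ## The two stub statements, named -/

/-- **Stub 1 statement — detector gap (spectral).** For every `K` and `χ₀ > 0` the GLH promise is contained in
the MOMENT promise: `glhYes ⊆ momentYes` and `glhNo ⊆ momentNo`. [folklore] -/
def DetectorGap : Prop :=
  ∀ (K : ℕ) (χ₀ : ℝ), 0 < χ₀ → glhYes K χ₀ ⊆ momentYes K χ₀ ∧ glhNo K ⊆ momentNo K

/-- **Stub 2 statement — moment threshold decision (algorithmic).** Granted the needle detector (the route's
support item `NeedleDetector`, = the antecedent of the crux), the MOMENT promise problem is in textbook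
promise-BPP for every `K` and `χ₀ > 0`. [folklore] -/
def MomentThresholdBPP : Prop :=
  NeedleDetector → ∀ (K : ℕ) (χ₀ : ℝ), 0 < χ₀ → momentProblem K χ₀ ∈ PromiseBPP'

/-! ## The two registered stubs -/

/-- **STUB 1 (M, true): detector gap.** Finite-dimensional spectral theorem for the Hermitian `H`
(`Matrix.IsHermitian.eigenvectorBasis`), `‖pauliString S‖ = 1` so `spec (H/(2Λ)) ⊆ [-1/2, 1/2]`,
`M(p) = Σ_j p(μ_j)|⟨v_j, u⟩|²`, Cauchy–Schwarz inside the witness eigenspace. Leans on: Mathlib spectral theorem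
for Hermitian matrices; tree `Literature.Computability.QuantumComplexity.Pauli.conjTranspose_mat`, `Pauli.mat_mul_self`.
Sources: GharibianLegall2022 (§3, the guided promise), Gall2024. -/
theorem stub_detectorGap : DetectorGap := by
  sorry

/-- **STUB 2 (L, load-bearing): moment threshold decision in `PromiseBPP'`.** Le Gall's Pauli-path moment
estimator run with a ONE-SIDED needle detector of ℓ¹-price `(2/δ₀)^{C/√ε} = n^{O(√K)}` (card T3): exact
evaluation of `⟨û|P|û⟩` on the guide's support, path sampling with dyadic rounding of the `ℤ[√2]` weights,
Hoeffding at threshold `2δ₀`, outright answers in the degenerate windows; one `P`-predicate on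
`⟨input, coins⟩` and one coin polynomial per `(K, χ₀)`. Leans on: `NeedleDetector` (hypothesis), the tree's
`PromiseBPP'` (Arora–Barak Def. 7.3 form), `FP` plumbing as in `PromiseBPPClosureProofs`.
Sources: Gall2024 / arXiv:2410.21833 (Thm 1, Lem 3), GharibianLegall2022 (Thm 1), MontanaroShao2023 (Prop 1.9),
KuczynskiWozniakowski1992. -/
theorem stub_momentThresholdBPP : MomentThresholdBPP := by
  sorry

/-! ## Sorry-free composition -/

/-- Textbook promise-BPP is monotone under shrinking the promise: if `Q'.yes ≤ Q.yes`, `Q'.no ≤ Q.no` and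
`Q ∈ PromiseBPP'` then `Q' ∈ PromiseBPP'` (same witness language and coin polynomial). [Goldreich 2006, §1.2]
[folklore] -/
theorem mem_PromiseBPP'_of_subset {Q Q' : PromiseProblem} (hy : Q'.yes ≤ Q.yes) (hn : Q'.no ≤ Q.no)
    (h : Q ∈ PromiseBPP') : Q' ∈ PromiseBPP' := by
  obtain ⟨L', hL', q, hyes, hno⟩ := h
  exact ⟨L', hL', q, fun x hx => hyes x (hy hx), fun x hx => hno x (hn hx)⟩

/-- **The real composition.** From the two stub statements (as hypotheses) the UNFOLDED crux follows:
moment decision (`h₂`) decides the larger MOMENT promise, detector gap (`h₁`) says the GLH promise is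
contained in it, and `PromiseBPP'` / `Encoding.toLanguage` are monotone. The conclusion is deliberately the
unfolded crux (`glhProblem K χ₀ ∈ PromiseBPP'` under the `NeedleDetector` antecedent) so that `NeedleBPP_of`
below is the only theorem whose head is the crux decl. [folklore] -/
theorem needleBPP_of_stubs (h₁ : DetectorGap) (h₂ : MomentThresholdBPP) :
    NeedleDetector → ∀ (K : ℕ) (χ₀ : ℝ), 0 < χ₀ → glhProblem K χ₀ ∈ PromiseBPP' := by
  intro hdet K χ₀ hχ
  refine mem_PromiseBPP'_of_subset ?_ ?_ (h₂ hdet K χ₀ hχ)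
  · exact Computability.Encoding.toLanguage_mono _ (h₁ K χ₀ hχ).1
  · exact Computability.Encoding.toLanguage_mono _ (h₁ K χ₀ hχ).2

/-- **THE skeleton theorem** — the crux `NeedleBPP` BY NAME from the two declared stubs via the sorry-free
composition `needleBPP_of_stubs` (`sorry` enters only through `stub_detectorGap` and
`stub_momentThresholdBPP`). [folklore] -/
theorem NeedleBPP_of : NeedleBPP :=
  needleBPP_of_stubs stub_detectorGap stub_momentThresholdBPP

end Summit.QuantumAdvantage.QuantumAdvantage.Cruxes.NeedleBPP.Birth

end
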